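import Literature.NumberTheory.LFunctions.KeiperPowerSeriesProofs
import Mathlib.NumberTheory.ModularForms.JacobiTheta.OneVariable
import HarnessLib

/-!
# Keiper 1992 — proofs, part 2 (cell `rh-crit/dbl`, row Ke92, rh-crit-dbl-t12): (28), (47), (3)/(5)–(7)

LINE 1 — LABEL: **RH-FREE** (theorems only; no definitions, no named facts, no hypothesis on the zeros
of `ζ`).  bears_on: LADDER-RH L-C/L-P (COLUMN 4, LI) — dictionary identities among Keiper's power-series
coefficients.  WHAT THIS IS NOT: identities for `τ_k` and for the Stieltjes constants; Keiper's
«RH ⟺ radius of convergence 1» is the sibling's `Keiper1992_rh_iff_radius_log_holds` and is an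
EQUIVALENCE, not a proof of either side; nothing here bears on the truth of RH.

Source: J. B. Keiper, *Power series expansions of Riemann's `ξ` function*, Math. Comp. **58** (1992)
765–773 [Keiper1992] (statements typed AS PRINTED in `KeiperPowerSeries.lean`, rh-crit-dbl-t6; first
discharges in `KeiperPowerSeriesProofs.lean`).

## Contents

* `Keiper1992_eq28_holds` — (28) p.768: `τ_k = −Σ_{j≥2} C(j+k−2, k) σ_j`, `k ≥ 1`.  Printed proof:
  «substituting (18) into» (25).  Here literally: (25) is the sibling's `Keiper1992_eq25_holds`
  (`τ_k = Σ_{j=1}^k C(k−1,j−1)(−1)^j σ_{j+1}`), (18) is the tree's `Keiper1992_eq18` =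
  `Coffey2008_eq410_holds` (`(−1)^{j+1} σ_{j+1} = Σ_i C(i+j,j) σ_{i+j+1}`), re-indexed to the index of
  `σ_j` (`hasSum_choose_mul_zetaZeroPowerSum_shift`); the finite sum of these convergent series is
  collected coefficientwise by Vandermonde's identity `Σ_l C(k−1,l) C(j−1,l+1) = C(j+k−2,k)`
  (`sum_choose_mul_choose_succ`, from Mathlib's `Nat.add_choose_eq`).

* `Keiper1992_eq47_holds` — (47) p.771: the recursion for the Stieltjes constants
  `γ_k/k! = (1/(k+1))(σ_{k+1} + ζ(k+1,3/2)/2^{k+1} − γ γ_{k−1}/(k−1)! − Σ_{j=1}^{k−1} (γ_{j−1}/(j−1)!)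
  [σ_{k+1−j} + ζ(k+1−j,3/2)/2^{k+1−j}])`, `k ≥ 1`.  Printed proof («by taking the exponential of» (46)),
  read on Taylor coefficients at `s = 1`: the Leibniz rule `(m+1)u_{m+1} = Σ_{i≤m} u_i q_{m−i}` for
  `ζ₁' = ζ₁·(ζ₁'/ζ₁)` (tree `Xiao2020.sum_zetaOneTaylorCoeff_mul`) with `u_{n+1} = (−1)ⁿγ_n/n!`
  ([Coffey2008] (3.1) = tree `Coffey2008_eq31_holds`) and `q_m = (−1)^m(σ_{m+1} + Σ_{k≥2}(2k−1)^{−m−1})`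
  ((46) = tree `Keiper1992_eq46`), at `m = k`, times `(−1)^k`.

* `Keiper1992_eq5_holds` — (5)–(7) p.766: `α_j = β_{j−2} + β_{j−1}` (`j ≥ 2`) for the Taylor
  coefficients `α_j` of `2ξ` at `s = 1`, `β₀ = 1 + γ/2 − log(2√π)`,
  `β_j = (1/j!)∫₁^∞ ψ(t)(log √t)^j t^{−1}(√t + (−1)^j) dt`.  Printed proof («by induction on (3)»),
  followed literally on top of Mathlib's construction of `Λ₀ = completedRiemannZeta₀` (tree
  `riemannXi s = ½ + ½ s(s−1) Λ₀(s)`): (3) is `hurwitzΛ₀_eq_mellin_add` — Mathlib's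
  `Λ₀ = 𝓜(f_modif)` folded onto `(1, ∞)` by `θ(t) = t^{−1/2}θ(1/t)` gives
  `Λ₀(s) = ∫₁^∞ ψ(t)(t^{s/2} + t^{(1−s)/2}) dt/t`; its Taylor coefficients at `1` are the `β_j`
  (`keiperBeta_coe_of_pos`: differentiation under the Mellin integral, Mathlib's
  `mellin_hasDerivAt_of_isBigO_rpow`, iterated — `iteratedDeriv_mellin`), `Λ₀(1) = α₁ = β₀` is the
  tree's `keiperAlpha_one`, and Leibniz on `½ s(s−1)·Λ₀` (`two_mul_iteratedDeriv_riemannXi_one`)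
  gives `α_j = β_{j−1} + β_{j−2}`.

## References

* [Keiper1992] J. B. Keiper, Math. Comp. 58 (1992) 765–773, doi:10.1090/S0025-5718-1992-1122072-5.
* [Coffey2008] M. W. Coffey, Proc. R. Soc. A 464 (2008) 711–731, eq. (4.10).
-/

noncomputable section

open Complex Filter Topology Finset
open scoped Nat ComplexConjugate

namespace Literature.NumberTheory.LFunctions

/-! ## [Keiper1992] (28): `τ_k = −Σ_{j≥2} C(j+k−2, k) σ_j` -/

/-- `Σ_{j ∈ Icc 1 n} g j = Σ_{i < n} g (i+1)`. [folklore] -/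
private theorem sum_Icc_one_eq_sum_range' {M : Type*} [AddCommMonoid M] (g : ℕ → M) (n : ℕ) :
    ∑ m ∈ Icc 1 n, g m = ∑ i ∈ range n, g (i + 1) := by
  rw [← Finset.Ico_add_one_right_eq_Icc, Finset.sum_Ico_eq_sum_range]
  simp only [Nat.add_sub_cancel, add_comm 1]

/-- Vandermonde's identity in the form used for (28): `Σ_{l<k} C(k−1, l) C(i+1, l+1) = C(i+k, k)`
(`k ≥ 1`). [folklore] -/
private theorem sum_choose_mul_choose_succ {k : ℕ} (hk : 1 ≤ k) (i : ℕ) :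
    ∑ l ∈ range k, (k - 1).choose l * (i + 1).choose (l + 1) = (i + k).choose k := by
  obtain ⟨m, rfl⟩ : ∃ m, k = m + 1 := ⟨k - 1, by omega⟩
  simp only [Nat.add_sub_cancel]
  have hV := Nat.add_choose_eq m (i + 1) (m + 1)
  rw [Finset.Nat.sum_antidiagonal_eq_sum_range_succ (fun a b ↦ m.choose a * (i + 1).choose b) (m + 1),
    Finset.sum_range_succ, Nat.choose_succ_self, zero_mul, add_zero] at hV
  rw [show i + (m + 1) = m + (i + 1) by ring, hV,
    ← Finset.sum_range_reflect (fun a ↦ m.choose a * (i + 1).choose (m + 1 - a)) (m + 1)]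
  refine Finset.sum_congr rfl fun l hl ↦ ?_
  have hl' := Finset.mem_range.1 hl
  simp only [Nat.add_sub_cancel]
  rw [Nat.choose_symm (by omega : l ≤ m), show m + 1 - (m - l) = l + 1 by omega]

/-- (18) shifted to the index `i = j − 2` of `σ_j`: for every `l`,
`Σ_{i≥0} C(i+1, l+1) σ_{i+2} = (−1)^l σ_{l+2}` (the terms `i < l` vanish).
[cite: Keiper1992, eq. (18) p.767] -/
private theorem hasSum_choose_mul_zetaZeroPowerSum_shift (l : ℕ) :
    HasSum (fun i : ℕ ↦ (((i + 1).choose (l + 1) : ℕ) : ℂ) * zetaZeroPowerSum (i + 2))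
      ((-1) ^ l * zetaZeroPowerSum (l + 2)) := by
  have h := Keiper1992_eq18 (l + 1)
  have e : (-1 : ℂ) ^ (l + 1 + 1) * zetaZeroPowerSum (l + 1 + 1) = (-1) ^ l * zetaZeroPowerSum (l + 2) := by
    rw [show l + 1 + 1 = l + 2 by ring, pow_add]; norm_num
  rw [e] at h
  refine (hasSum_nat_add_iff' l).1 ?_
  have hz : ∑ i ∈ range l, (((i + 1).choose (l + 1) : ℕ) : ℂ) * zetaZeroPowerSum (i + 2) = 0 :=
    Finset.sum_eq_zero fun i hi ↦ by
      rw [Nat.choose_eq_zero_of_lt (by have := Finset.mem_range.1 hi; omega)]; simp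
  rw [hz, sub_zero]
  refine h.congr_fun fun i ↦ ?_
  show (((i + l + 1).choose (l + 1) : ℕ) : ℂ) * zetaZeroPowerSum (i + l + 2) = _
  rw [show i + l + 1 = i + (l + 1) by ring, show i + l + 2 = i + (l + 1) + 1 by ring]

/-- **[Keiper1992] (28) — DISCHARGED**: `τ_k = −Σ_{j≥2} C(j+k−2, k) σ_j` for `k ≥ 1` («substituting (18)
into» (25)): insert the shifted (18) into the finite sum (25) (`Keiper1992_eq25_holds`) and collect the
coefficient of `σ_j` by Vandermonde's identity `Σ_l C(k−1,l) C(j−1,l+1) = C(j+k−2,k)`.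
[cite: Keiper1992, eq. (28) p.768] -/
theorem Keiper1992_eq28_holds : Keiper1992_eq28 := by
  intro k hk
  -- (25), re-indexed by `l = j − 1 ∈ range k`
  have h25c : (keiperTau k : ℂ) =
      ∑ l ∈ range k, (-1 : ℂ) ^ (l + 1) * (((k - 1).choose l : ℕ) : ℂ) * zetaZeroPowerSum (l + 2) := by
    rw [Keiper1992_eq25_holds k hk, sum_Icc_one_eq_sum_range']
    refine Finset.sum_congr rfl fun l _ ↦ ?_
    rw [show l + 1 - 1 = l by omega, show l + 1 + 1 = l + 2 by ring]
    ring
  -- the finite sum over `l` of the shifted (18)'s, with coefficients `C(k−1, l)`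
  have hS : HasSum (fun i : ℕ ↦ ∑ l ∈ range k, (((k - 1).choose l : ℕ) : ℂ) *
      ((((i + 1).choose (l + 1) : ℕ) : ℂ) * zetaZeroPowerSum (i + 2)))
      (∑ l ∈ range k, (((k - 1).choose l : ℕ) : ℂ) * ((-1) ^ l * zetaZeroPowerSum (l + 2))) :=
    hasSum_sum fun l _ ↦ (hasSum_choose_mul_zetaZeroPowerSum_shift l).mul_left _
  -- the coefficient of `σ_{i+2}` is `C(i+k, k)`
  have hT : ∀ i : ℕ, ∑ l ∈ range k, (((k - 1).choose l : ℕ) : ℂ) *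
      ((((i + 1).choose (l + 1) : ℕ) : ℂ) * zetaZeroPowerSum (i + 2)) =
      (((i + k).choose k : ℕ) : ℂ) * zetaZeroPowerSum (i + 2) := by
    intro i
    rw [← sum_choose_mul_choose_succ hk i]
    push_cast
    rw [Finset.sum_mul]
    exact Finset.sum_congr rfl fun l _ ↦ by ring
  simp only [hT] at hS
  -- and the value is `−τ_k`
  have hv : ∑ l ∈ range k, (((k - 1).choose l : ℕ) : ℂ) * ((-1) ^ l * zetaZeroPowerSum (l + 2)) =
      -(keiperTau k : ℂ) := by
    rw [h25c, ← Finset.sum_neg_distrib]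
    exact Finset.sum_congr rfl fun l _ ↦ by ring
  rw [hv] at hS
  have h := hS.neg
  rw [neg_neg] at h
  exact h

/-! ## [Keiper1992] (47): the recursion for the Stieltjes constants -/

/-- (46) solved for `q_m`: `q_m = (−1)^m (σ_{m+1} + Σ_{i≥0}(2i+3)^{−(m+1)})`, `m ≥ 1`.
[cite: Keiper1992, eq. (46) p.771] -/
private theorem zetaOneLogDerivCoeff_eq_of_eq46 {n : ℕ} (hn : 1 ≤ n) :
    Xiao2020.zetaOneLogDerivCoeff n =
      (-1) ^ n * (zetaZeroPowerSum (n + 1) + keiperOddTail (n + 1)) := by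
  have h := (Keiper1992_eq46.2 n hn).tsum_eq
  have hpm : ((-1 : ℂ) ^ n) * (-1) ^ n = 1 := by rw [← mul_pow]; norm_num
  rw [keiperOddTail, h]
  linear_combination (-(Xiao2020.zetaOneLogDerivCoeff n)) * hpm

/-- (3.1): `u_{n+1} = (−1)ⁿ γ_n / n!` in `ℂ`. [cite: Coffey2008, eq. (3.1) p.714] -/
private theorem zetaOneTaylorCoeff_succ_eq (n : ℕ) :
    Xiao2020.zetaOneTaylorCoeff (n + 1) = (-1) ^ n * (stieltjesGamma n : ℂ) / (n ! : ℂ) := by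
  rw [Coffey2008_eq31_holds n]
  push_cast
  ring

/-- **[Keiper1992] (47) — DISCHARGED**: the recursion for the Stieltjes constants,
`γ_k/k! = (1/(k+1)) (σ_{k+1} + ζ(k+1,3/2)/2^{k+1} − γ γ_{k−1}/(k−1)!
  − Σ_{j=1}^{k−1} (γ_{j−1}/(j−1)!)[σ_{k+1−j} + ζ(k+1−j,3/2)/2^{k+1−j}])`, `k ≥ 1`.
Printed proof («by taking the exponential of this series», i.e. of (46)): on Taylor coefficients at
`s = 1` this is the Leibniz rule for `ζ₁' = ζ₁ · (ζ₁'/ζ₁)`, `(m+1)u_{m+1} = Σ_{i≤m} u_i q_{m−i}` (tree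
`Xiao2020.sum_zetaOneTaylorCoeff_mul`), with `u_0 = 1`, `u_{n+1} = (−1)ⁿγ_n/n!` ((3.1) =
`Coffey2008_eq31_holds`), `q_0 = γ` and `q_m = (−1)^m(σ_{m+1} + Σ_{k≥2}(2k−1)^{−(m+1)})` ((46) =
`Keiper1992_eq46`), at `m = k`, multiplied by `(−1)^k`. [cite: Keiper1992, eq. (47) p.771] -/
theorem Keiper1992_eq47_holds : Keiper1992_eq47 := by
  intro k hk
  obtain ⟨m, rfl⟩ : ∃ m, k = m + 1 := ⟨k - 1, by omega⟩
  simp only [Nat.add_sub_cancel]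
  rw [sum_Icc_one_eq_sum_range']
  -- the printed right-hand sum, re-indexed by `i = j − 1 < m`
  set X : ℕ → ℂ := fun i ↦ zetaZeroPowerSum (m + 1 - i) + keiperOddTail (m + 1 - i) with hX
  have hRHS : ∑ i ∈ range m, (stieltjesGamma (i + 1 - 1) : ℂ) / ((i + 1 - 1)! : ℂ) *
      (zetaZeroPowerSum (m + 1 + 1 - (i + 1)) + keiperOddTail (m + 1 + 1 - (i + 1))) =
      ∑ i ∈ range m, (stieltjesGamma i : ℂ) / (i ! : ℂ) * X i := by
    refine Finset.sum_congr rfl fun i _ ↦ ?_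
    simp only [Nat.add_sub_cancel, Nat.add_sub_add_right, hX]
  rw [hRHS]
  -- Leibniz at `m + 1`, end terms peeled off
  have hL := Xiao2020.sum_zetaOneTaylorCoeff_mul (m + 1)
  rw [Finset.sum_range_succ, Finset.sum_range_succ'] at hL
  simp only [Nat.sub_self, Nat.sub_zero, Nat.add_sub_add_right, Xiao2020.zetaOneTaylorCoeff_zero,
    one_mul, Keiper1992_eq46.1, zetaOneTaylorCoeff_succ_eq,
    zetaOneLogDerivCoeff_eq_of_eq46 (Nat.le_add_left 1 m)] at hL
  -- the middle terms: `u_{i+1} q_{m−i} = (−1)^m (γ_i/i!) X_i`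
  have hmid : ∑ i ∈ range m, (-1) ^ i * (stieltjesGamma i : ℂ) / (i ! : ℂ) *
      Xiao2020.zetaOneLogDerivCoeff (m - i) =
      (-1) ^ m * ∑ i ∈ range m, (stieltjesGamma i : ℂ) / (i ! : ℂ) * X i := by
    rw [Finset.mul_sum]
    refine Finset.sum_congr rfl fun i hi ↦ ?_
    have hi' := Finset.mem_range.1 hi
    rw [zetaOneLogDerivCoeff_eq_of_eq46 (by omega : 1 ≤ m - i),
      show m - i + 1 = m + 1 - i by omega]
    have hp : (-1 : ℂ) ^ i * (-1) ^ (m - i) = (-1) ^ m := by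
      rw [← pow_add, Nat.add_sub_cancel' hi'.le]
    linear_combination ((stieltjesGamma i : ℂ) / (i ! : ℂ) * X i) * hp
  rw [hmid] at hL
  have hε : ((-1 : ℂ) ^ m) * (-1) ^ m = 1 := by rw [← mul_pow]; norm_num
  have hm2 : ((m : ℂ) + 1 + 1) ≠ 0 := by norm_cast
  have hmain : ((m : ℂ) + 1 + 1) * ((stieltjesGamma (m + 1) : ℂ) / ((m + 1)! : ℂ)) =
      zetaZeroPowerSum (m + 1 + 1) + keiperOddTail (m + 1 + 1)
        - (Real.eulerMascheroniConstant : ℂ) * (stieltjesGamma m : ℂ) / (m ! : ℂ)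
        - ∑ i ∈ range m, (stieltjesGamma i : ℂ) / (i ! : ℂ) * X i := by
    push_cast at hL
    rw [pow_succ] at hL
    linear_combination ((-1 : ℂ) ^ m) * hL
      + (zetaZeroPowerSum (m + 1 + 1) + keiperOddTail (m + 1 + 1)
          - (Real.eulerMascheroniConstant : ℂ) * (stieltjesGamma m : ℂ) / (m ! : ℂ)
          - ∑ i ∈ range m, (stieltjesGamma i : ℂ) / (i ! : ℂ) * X i
          - ((m : ℂ) + 1 + 1) * ((stieltjesGamma (m + 1) : ℂ) / ((m + 1)! : ℂ))) * hε
  push_cast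
  rw [← hmain]
  field_simp

section RiemannIntegral

open Set MeasureTheory Asymptotics HurwitzZeta

/-! ## [Keiper1992] (3) and (5)–(7): Riemann's theta integral and the coefficients `α_j`, `β_j` -/

/-! ### The fields of Mathlib's `hurwitzEvenFEPair 0` (`f = θ`, `k = ½`, `ε = 1`, `f₀ = g₀ = 1`) -/

/-- `f = θ`. [folklore] -/
private theorem hP_f (x : ℝ) : (hurwitzEvenFEPair 0).f x = ((evenKernel 0 x : ℝ) : ℂ) := rfl
/-- `f₀ = 1`. [folklore] -/
private theorem hP_f₀ : (hurwitzEvenFEPair 0).f₀ = 1 := by simp [hurwitzEvenFEPair]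
/-- `ε = 1`. [folklore] -/
private theorem hP_ε : (hurwitzEvenFEPair 0).ε = 1 := rfl
/-- `k = ½`. [folklore] -/
private theorem hP_k : (hurwitzEvenFEPair 0).k = 1 / 2 := rfl
/-- `g₀ = 1`. [folklore] -/
private theorem hP_g₀ : (hurwitzEvenFEPair 0).g₀ = 1 := rfl

/-- `θ(t) = t^{−1/2} θ(1/t)` for `θ = evenKernel 0` (Jacobi). [folklore] -/
private theorem evenKernel_zero_FE {t : ℝ} (ht : 0 < t) :
    evenKernel 0 t = t ^ (-(1 / 2 : ℝ)) * evenKernel 0 t⁻¹ := by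
  have h := evenKernel_functional_equation 0 t
  rw [← evenKernel_eq_cosKernel_of_zero] at h
  rw [h, Real.rpow_neg ht.le, one_div (t ^ _), one_div t]

/-- Mathlib's `f_modif` for `ζ`, folded onto `(1, ∞)`: on `(0, ∞)`,
`f_modif t = G t + t^{−1/2} G(1/t)` with `G = 𝟙_{(1,∞)} (θ − 1)`. [folklore] -/
private theorem f_modif_eq {t : ℝ} (ht : 0 < t) :
    (hurwitzEvenFEPair 0).f_modif t =
      (Ioi (1 : ℝ)).indicator (fun x : ℝ ↦ ((evenKernel 0 x : ℝ) : ℂ) - 1) t +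
        (t : ℂ) ^ (-(1 / 2 : ℂ)) •
          (Ioi (1 : ℝ)).indicator (fun x : ℝ ↦ ((evenKernel 0 x : ℝ) : ℂ) - 1) t⁻¹ := by
  rw [WeakFEPair.f_modif, Pi.add_apply, hP_f₀, hP_ε, hP_k, hP_g₀]
  have hc : (t : ℂ) ^ (-(1 / 2 : ℂ)) = ((t ^ (-(1 / 2 : ℝ)) : ℝ) : ℂ) := by
    rw [Complex.ofReal_cpow ht.le]; push_cast; rfl
  rcases lt_trichotomy t 1 with h | rfl | h
  · have h1 : t ∉ Ioi (1 : ℝ) := by simp [h.le]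
    have h2 : t ∈ Ioo (0 : ℝ) 1 := ⟨ht, h⟩
    have h3 : t⁻¹ ∈ Ioi (1 : ℝ) := by
      rw [Set.mem_Ioi]; exact (one_lt_inv_iff₀).2 ⟨ht, h⟩
    rw [indicator_of_notMem h1, indicator_of_notMem h1, indicator_of_mem h2, indicator_of_mem h3,
      zero_add, zero_add, hc,
      show (hurwitzEvenFEPair 0).f t = ((evenKernel 0 t : ℝ) : ℂ) from rfl, evenKernel_zero_FE ht,
      smul_eq_mul, smul_eq_mul]
    push_cast
    ring
  · simp
  · have h1 : t ∈ Ioi (1 : ℝ) := h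
    have h2 : t ∉ Ioo (0 : ℝ) 1 := fun hh ↦ absurd hh.2 (not_lt.2 h.le)
    have h3 : t⁻¹ ∉ Ioi (1 : ℝ) := by
      rw [Set.mem_Ioi, not_lt]; exact inv_le_one_of_one_le₀ h.le
    rw [indicator_of_mem h1, indicator_of_mem h1, indicator_of_notMem h2, indicator_of_notMem h3,
      smul_zero, add_zero, add_zero]
    rfl

/-- `G = 𝟙_{(1,∞)}(θ − 1)` is locally integrable on `(0, ∞)`. [folklore] -/
private theorem locallyIntegrableOn_G :
    LocallyIntegrableOn ((Ioi (1 : ℝ)).indicator (fun x : ℝ ↦ ((evenKernel 0 x : ℝ) : ℂ) - 1))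
      (Ioi 0) := by
  intro x hx
  obtain ⟨u, hu, hu'⟩ := ((hurwitzEvenFEPair 0).hf_int.sub (locallyIntegrableOn_const 1)) x hx
  exact ⟨u, hu, hu'.indicator measurableSet_Ioi⟩

/-- `G` decays faster than any power at `∞` (from `θ − 1 = O(e^{−πt})`). [folklore] -/
private theorem isBigO_G_atTop (a : ℝ) :
    (Ioi (1 : ℝ)).indicator (fun x : ℝ ↦ ((evenKernel 0 x : ℝ) : ℂ) - 1) =O[atTop]
      fun t : ℝ ↦ t ^ (-a) := by
  refine ((hurwitzEvenFEPair 0).hf_top (-a)).congr' ?_ EventuallyEq.rfl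
  filter_upwards [eventually_gt_atTop 1] with x hx
  rw [indicator_of_mem (Set.mem_Ioi.2 hx), hP_f₀]
  rfl

/-- `G` vanishes on `(0, 1)`. [folklore] -/
private theorem G_eventually_zero :
    ∀ᶠ t in 𝓝[>] (0 : ℝ),
      (Ioi (1 : ℝ)).indicator (fun x : ℝ ↦ ((evenKernel 0 x : ℝ) : ℂ) - 1) t = 0 := by
  filter_upwards [Ioo_mem_nhdsGT zero_lt_one] with t ht
  exact indicator_of_notMem (by simp [ht.2.le]) _

/-! ### Mellin transforms of `logⁿ · G` for a `G` with every power decay at `∞`, vanishing near `0` -/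

section MellinLog

variable {G : ℝ → ℂ}

/-- `logⁿ·G` keeps every power decay at `∞`. [folklore] -/
private theorem log_pow_smul_isBigO_atTop (htop : ∀ a : ℝ, G =O[atTop] fun t : ℝ ↦ t ^ (-a))
    (n : ℕ) (a : ℝ) :
    (fun t : ℝ ↦ Real.log t ^ n • G t) =O[atTop] fun t : ℝ ↦ t ^ (-a) := by
  induction n generalizing a with
  | zero => simpa using htop a
  | succ n ih =>
    have h := isBigO_rpow_top_log_smul (lt_add_one a) (ih (a + 1))
    refine h.congr' (Eventually.of_forall fun t ↦ ?_) EventuallyEq.rfl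
    simp only [smul_smul, pow_succ']

/-- `logⁿ·G` vanishes near `0`. [folklore] -/
private theorem log_pow_smul_isBigO_zero (hbot : ∀ᶠ t in 𝓝[>] (0 : ℝ), G t = 0) (n : ℕ) (b : ℝ) :
    (fun t : ℝ ↦ Real.log t ^ n • G t) =O[𝓝[>] (0 : ℝ)] fun t : ℝ ↦ t ^ (-b) := by
  refine (isBigO_zero _ _).congr' ?_ EventuallyEq.rfl
  filter_upwards [hbot] with t ht
  simp [ht]

/-- `logⁿ·G` is locally integrable on `(0, ∞)`. [folklore] -/
private theorem log_pow_smul_locallyIntegrableOn (hfc : LocallyIntegrableOn G (Ioi 0)) (n : ℕ) :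
    LocallyIntegrableOn (fun t : ℝ ↦ Real.log t ^ n • G t) (Ioi 0) :=
  hfc.continuousOn_smul isOpen_Ioi.isLocallyClosed
    ((Real.continuousOn_log.mono fun t (ht : 0 < t) ↦ ht.ne').pow n)

/-- `𝓜(logⁿ·G)` converges everywhere and `d/ds 𝓜(logⁿ·G) = 𝓜(logⁿ⁺¹·G)`. [folklore] -/
private theorem hasDerivAt_mellin_log_pow_smul (hfc : LocallyIntegrableOn G (Ioi 0))
    (htop : ∀ a : ℝ, G =O[atTop] fun t : ℝ ↦ t ^ (-a)) (hbot : ∀ᶠ t in 𝓝[>] (0 : ℝ), G t = 0)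
    (n : ℕ) (s : ℂ) :
    MellinConvergent (fun t : ℝ ↦ Real.log t ^ n • G t) s ∧
      HasDerivAt (mellin fun t : ℝ ↦ Real.log t ^ n • G t)
        (mellin (fun t : ℝ ↦ Real.log t ^ (n + 1) • G t) s) s := by
  have hc := mellinConvergent_of_isBigO_rpow (log_pow_smul_locallyIntegrableOn hfc n)
    (log_pow_smul_isBigO_atTop htop n (s.re + 1)) (by linarith)
    (log_pow_smul_isBigO_zero hbot n (s.re - 1)) (by linarith)
  have h := mellin_hasDerivAt_of_isBigO_rpow (log_pow_smul_locallyIntegrableOn hfc n)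
    (log_pow_smul_isBigO_atTop htop n (s.re + 1)) (by linarith)
    (log_pow_smul_isBigO_zero hbot n (s.re - 1)) (by linarith)
  have e : (fun t : ℝ ↦ Real.log t • (Real.log t ^ n • G t)) =
      fun t : ℝ ↦ Real.log t ^ (n + 1) • G t := by
    funext t; simp only [smul_smul, pow_succ']
  rw [e] at h
  exact ⟨hc, h.2⟩

/-- `(𝓜G)^{(n)} = 𝓜(logⁿ·G)`. [folklore] -/
private theorem iteratedDeriv_mellin (hfc : LocallyIntegrableOn G (Ioi 0))
    (htop : ∀ a : ℝ, G =O[atTop] fun t : ℝ ↦ t ^ (-a)) (hbot : ∀ᶠ t in 𝓝[>] (0 : ℝ), G t = 0)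
    (n : ℕ) :
    iteratedDeriv n (mellin G) = mellin fun t : ℝ ↦ Real.log t ^ n • G t := by
  induction n with
  | zero => simp
  | succ n ih =>
    rw [iteratedDeriv_succ, ih]
    funext s
    exact (hasDerivAt_mellin_log_pow_smul hfc htop hbot n s).2.deriv

/-- `𝓜G` is entire. [folklore] -/
private theorem differentiable_mellin (hfc : LocallyIntegrableOn G (Ioi 0))
    (htop : ∀ a : ℝ, G =O[atTop] fun t : ℝ ↦ t ^ (-a)) (hbot : ∀ᶠ t in 𝓝[>] (0 : ℝ), G t = 0) :
    Differentiable ℂ (mellin G) := fun s ↦ by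
  simpa using (hasDerivAt_mellin_log_pow_smul hfc htop hbot 0 s).2.differentiableAt

end MellinLog

/-! ### Riemann's integral (3): `Λ₀(s) = 𝓜G(s) + 𝓜G(½ − s)` -/

/-- `𝓜G(s)` converges for every `s`. [folklore] -/
private theorem mellinConvergent_G (s : ℂ) :
    MellinConvergent ((Ioi (1 : ℝ)).indicator (fun x : ℝ ↦ ((evenKernel 0 x : ℝ) : ℂ) - 1)) s := by
  simpa using (hasDerivAt_mellin_log_pow_smul locallyIntegrableOn_G isBigO_G_atTop
    G_eventually_zero 0 s).1

/-- **[Keiper1992] (3) in Mellin form** (Riemann): Mathlib's `Λ₀ = 𝓜(f_modif)` for `ζ` equals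
`𝓜G(s) + 𝓜G(½ − s)`, `G = 𝟙_{(1,∞)}(θ − 1) = 2ψ·𝟙_{(1,∞)}`; i.e.
`2ξ(s) = 1 + s(s−1) ∫₁^∞ ψ(t)(t^{s/2} + t^{(1−s)/2}) dt/t`. [cite: Keiper1992, eq. (3) p.766] -/
private theorem hurwitzΛ₀_eq_mellin_add (s : ℂ) :
    (hurwitzEvenFEPair 0).Λ₀ s =
      mellin ((Ioi (1 : ℝ)).indicator (fun x : ℝ ↦ ((evenKernel 0 x : ℝ) : ℂ) - 1)) s +
        mellin ((Ioi (1 : ℝ)).indicator (fun x : ℝ ↦ ((evenKernel 0 x : ℝ) : ℂ) - 1))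
          (1 / 2 - s) := by
  set G : ℝ → ℂ := (Ioi (1 : ℝ)).indicator (fun x : ℝ ↦ ((evenKernel 0 x : ℝ) : ℂ) - 1) with hG
  have hH : MellinConvergent (fun t : ℝ ↦ (t : ℂ) ^ (-(1 / 2 : ℂ)) • G t⁻¹) s := by
    rw [MellinConvergent.cpow_smul]
    have h := (MellinConvergent.comp_rpow (f := G) (s := s + -(1 / 2 : ℂ)) (a := -1)
      (by norm_num)).2 (mellinConvergent_G _)
    simpa only [Real.rpow_neg_one] using h
  have h1 : (hurwitzEvenFEPair 0).Λ₀ s =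
      ∫ t : ℝ in Ioi 0, ((t : ℂ) ^ (s - 1) • G t +
        (t : ℂ) ^ (s - 1) • ((t : ℂ) ^ (-(1 / 2 : ℂ)) • G t⁻¹)) := by
    rw [WeakFEPair.Λ₀, mellin]
    refine setIntegral_congr_fun measurableSet_Ioi fun t ht ↦ ?_
    rw [f_modif_eq ht, smul_add]
  rw [h1, integral_add (mellinConvergent_G s) hH]
  change mellin G s + mellin (fun t : ℝ ↦ (t : ℂ) ^ (-(1 / 2 : ℂ)) • G t⁻¹) s = _
  rw [mellin_cpow_smul, mellin_comp_inv, show -(s + -(1 / 2 : ℂ)) = 1 / 2 - s by ring]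

/-! ### `ψ = (θ − 1)/2` -/

/-- For `t > 0`: `Σ_{n≥1} e^{−n²πt} = (θ(t) − 1)/2`, `θ = evenKernel 0` (Mathlib's
`hasSum_nat_jacobiTheta` at `τ = it`). [folklore] -/
private theorem tsum_cexp_eq {t : ℝ} (ht : 0 < t) :
    ∑' n : ℕ, cexp (-((n : ℂ) + 1) ^ 2 * (Real.pi : ℂ) * (t : ℂ)) =
      (((evenKernel 0 t : ℝ) : ℂ) - 1) / 2 := by
  have hθ : ((evenKernel 0 t : ℝ) : ℂ) = jacobiTheta (I * t) := by
    have h := evenKernel_def 0 t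
    simp only [QuotientAddGroup.mk_zero, ofReal_zero] at h
    rw [h, jacobiTheta_eq_jacobiTheta₂]
    simp
  have hτ : 0 < (I * t).im := by simp [ht]
  have hs := hasSum_nat_jacobiTheta hτ
  rw [← hθ] at hs
  rw [← hs.tsum_eq]
  refine tsum_congr fun n ↦ ?_
  congr 1
  ring_nf
  rw [I_sq]
  ring

/-! ### The Taylor coefficients of `Λ₀ = completedRiemannZeta₀` at `s = 1` -/

/-- (3) at the level of Mathlib's `completedRiemannZeta₀`:
`Λ₀(s) = (𝓜G(s/2) + 𝓜G((1−s)/2))/2`. [cite: Keiper1992, eq. (3) p.766] -/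
private theorem completedRiemannZeta₀_eq (s : ℂ) :
    completedRiemannZeta₀ s =
      (mellin ((Ioi (1 : ℝ)).indicator (fun x : ℝ ↦ ((evenKernel 0 x : ℝ) : ℂ) - 1))
          ((1 / 2 : ℂ) * s) +
        mellin ((Ioi (1 : ℝ)).indicator (fun x : ℝ ↦ ((evenKernel 0 x : ℝ) : ℂ) - 1))
          (1 / 2 + -(1 / 2 : ℂ) * s)) / 2 := by
  rw [show (1 / 2 : ℂ) * s = s / 2 by ring, show (1 / 2 : ℂ) + -(1 / 2 : ℂ) * s = 1 / 2 - s / 2 by ring]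
  show (hurwitzEvenFEPair 0).Λ₀ (s / 2) / 2 = _
  rw [hurwitzΛ₀_eq_mellin_add]

/-- `Λ₀^{(n)}(1) = ((1/2)^n 𝓜(logⁿ·G)(1/2) + (−1/2)^n 𝓜(logⁿ·G)(0)) / 2` (differentiating (3) under the
integral sign). [cite: Keiper1992, eqs. (3), (7) p.766] -/
private theorem iteratedDeriv_completedRiemannZeta₀_one (n : ℕ) :
    iteratedDeriv n completedRiemannZeta₀ 1 =
      ((1 / 2 : ℂ) ^ n *
          mellin (fun t : ℝ ↦ Real.log t ^ n •
            (Ioi (1 : ℝ)).indicator (fun x : ℝ ↦ ((evenKernel 0 x : ℝ) : ℂ) - 1) t) (1 / 2) +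
        (-(1 / 2 : ℂ)) ^ n *
          mellin (fun t : ℝ ↦ Real.log t ^ n •
            (Ioi (1 : ℝ)).indicator (fun x : ℝ ↦ ((evenKernel 0 x : ℝ) : ℂ) - 1) t) 0) / 2 := by
  set M : ℂ → ℂ := mellin ((Ioi (1 : ℝ)).indicator (fun x : ℝ ↦ ((evenKernel 0 x : ℝ) : ℂ) - 1))
    with hM
  have hMd : ContDiff ℂ n M :=
    (differentiable_mellin locallyIntegrableOn_G isBigO_G_atTop G_eventually_zero).contDiff
  have hF : completedRiemannZeta₀ =
      fun s ↦ (M ((1 / 2 : ℂ) * s) + (fun u : ℂ ↦ M (1 / 2 + u)) (-(1 / 2 : ℂ) * s)) / 2 := by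
    funext s; exact completedRiemannZeta₀_eq s
  have h1 : ContDiff ℂ n (fun s : ℂ ↦ M ((1 / 2 : ℂ) * s)) := hMd.comp (contDiff_const.mul contDiff_id)
  have hM2 : ContDiff ℂ n (fun u : ℂ ↦ M (1 / 2 + u)) := hMd.comp (contDiff_const.add contDiff_id)
  have h2 : ContDiff ℂ n (fun s : ℂ ↦ (fun u : ℂ ↦ M (1 / 2 + u)) (-(1 / 2 : ℂ) * s)) :=
    hM2.comp (contDiff_const.mul contDiff_id)
  have e1 := congrFun (iteratedDeriv_comp_const_mul hMd (1 / 2 : ℂ)) 1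
  have e2 := congrFun (iteratedDeriv_comp_const_mul hM2 (-(1 / 2 : ℂ))) 1
  have e3 := congrFun (iteratedDeriv_comp_const_add n M (1 / 2 : ℂ)) (-(1 / 2 : ℂ) * 1)
  rw [hF, iteratedDeriv_div_const, iteratedDeriv_fun_add h1.contDiffAt h2.contDiffAt, e1, e2, e3,
    hM, iteratedDeriv_mellin locallyIntegrableOn_G isBigO_G_atTop G_eventually_zero n]
  norm_num

/-- On `(1, ∞)`: `t^{s−1} • (logⁿ t • G t) = t^{s−1} (log t)ⁿ (θ(t) − 1)`. [folklore] -/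
private theorem cpow_smul_log_pow_G {t : ℝ} (ht : 1 < t) (s : ℂ) (n : ℕ) :
    (t : ℂ) ^ (s - 1) • (Real.log t ^ n •
        (Ioi (1 : ℝ)).indicator (fun x : ℝ ↦ ((evenKernel 0 x : ℝ) : ℂ) - 1) t) =
      (t : ℂ) ^ (s - 1) * ((Real.log t : ℂ) ^ n * (((evenKernel 0 t : ℝ) : ℂ) - 1)) := by
  rw [indicator_of_mem (Set.mem_Ioi.2 ht), Complex.real_smul, smul_eq_mul, ofReal_pow]

/-- `𝓜(logⁿ·G)(s) = ∫₁^∞ t^{s−1} (log t)ⁿ (θ(t) − 1) dt`. [folklore] -/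
private theorem mellin_log_pow_G (n : ℕ) (s : ℂ) :
    mellin (fun t : ℝ ↦ Real.log t ^ n •
        (Ioi (1 : ℝ)).indicator (fun x : ℝ ↦ ((evenKernel 0 x : ℝ) : ℂ) - 1) t) s =
      ∫ t : ℝ in Ioi 1, (t : ℂ) ^ (s - 1) * ((Real.log t : ℂ) ^ n * (((evenKernel 0 t : ℝ) : ℂ) - 1)) := by
  rw [mellin]
  have h : ∀ t ∈ Ioi (0 : ℝ), (t : ℂ) ^ (s - 1) • (Real.log t ^ n •
      (Ioi (1 : ℝ)).indicator (fun x : ℝ ↦ ((evenKernel 0 x : ℝ) : ℂ) - 1) t) =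
      (Ioi (1 : ℝ)).indicator
        (fun t : ℝ ↦ (t : ℂ) ^ (s - 1) * ((Real.log t : ℂ) ^ n * (((evenKernel 0 t : ℝ) : ℂ) - 1))) t := by
    intro t _
    by_cases h : t ∈ Ioi (1 : ℝ)
    · rw [cpow_smul_log_pow_G (Set.mem_Ioi.1 h), indicator_of_mem h]
    · rw [indicator_of_notMem h, indicator_of_notMem h, smul_zero, smul_zero]
  rw [setIntegral_congr_fun measurableSet_Ioi h, setIntegral_indicator measurableSet_Ioi,
    Set.Ioi_inter_Ioi, sup_eq_right.2 zero_le_one]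

/-- The integrand `t^{s−1}(log t)ⁿ(θ − 1)` is integrable on `(1, ∞)`. [folklore] -/
private theorem integrableOn_cpow_log_pow (n : ℕ) (s : ℂ) :
    IntegrableOn (fun t : ℝ ↦ (t : ℂ) ^ (s - 1) * ((Real.log t : ℂ) ^ n *
      (((evenKernel 0 t : ℝ) : ℂ) - 1))) (Ioi 1) := by
  have h := (hasDerivAt_mellin_log_pow_smul locallyIntegrableOn_G isBigO_G_atTop
    G_eventually_zero n s).1
  rw [MellinConvergent] at h
  exact (h.mono_set (Set.Ioi_subset_Ioi zero_le_one)).congr_fun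
    (fun t ht ↦ cpow_smul_log_pow_G (Set.mem_Ioi.1 ht) s n) measurableSet_Ioi

/-- **[Keiper1992] (7) identified**: for `m ≥ 1`, `β_m = Λ₀^{(m)}(1)/m!` — the Taylor coefficients
of Riemann's integral `∫₁^∞ ψ(t)(t^{(1−s)/2} + t^{s/2}) dt/t` at `s = 1`.
[cite: Keiper1992, eqs. (3), (7) p.766] -/
private theorem keiperBeta_coe_of_pos {m : ℕ} (hm : 1 ≤ m) :
    (keiperBeta m : ℂ) = iteratedDeriv m completedRiemannZeta₀ 1 / (m ! : ℂ) := by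
  obtain ⟨i, rfl⟩ : ∃ i, m = i + 1 := ⟨m - 1, by omega⟩
  rw [iteratedDeriv_completedRiemannZeta₀_one, mellin_log_pow_G, mellin_log_pow_G, keiperBeta,
    neg_pow (1 / 2 : ℂ) (i + 1)]
  push_cast
  rw [← integral_complex_ofReal]
  have hA := integrableOn_cpow_log_pow (i + 1) (1 / 2)
  have hB := integrableOn_cpow_log_pow (i + 1) 0
  have hpt : ∀ t ∈ Ioi (1 : ℝ),
      (((∑' n : ℕ, Real.exp (-((n : ℝ) + 1) ^ 2 * Real.pi * t)) * Real.log (√t) ^ (i + 1) / t *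
        (√t + (-1) ^ (i + 1)) : ℝ) : ℂ) =
      1 / 2 * (1 / 2) ^ (i + 1) *
          ((t : ℂ) ^ ((1 / 2 : ℂ) - 1) * ((Real.log t : ℂ) ^ (i + 1) * (((evenKernel 0 t : ℝ) : ℂ) - 1))) +
        1 / 2 * ((-1) ^ (i + 1) * (1 / 2 : ℂ) ^ (i + 1)) *
          ((t : ℂ) ^ ((0 : ℂ) - 1) * ((Real.log t : ℂ) ^ (i + 1) * (((evenKernel 0 t : ℝ) : ℂ) - 1))) := by
    intro t ht
    have ht0 : 0 < t := lt_trans zero_lt_one ht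
    have htc : (t : ℂ) ≠ 0 := ofReal_ne_zero.2 ht0.ne'
    have hs : (t : ℂ) ^ ((1 / 2 : ℂ) - 1) = ((√t : ℝ) : ℂ) / (t : ℂ) := by
      rw [cpow_sub _ _ htc, cpow_one, Real.sqrt_eq_rpow, Complex.ofReal_cpow ht0.le]
      push_cast
      rfl
    have h0 : (t : ℂ) ^ ((0 : ℂ) - 1) = (t : ℂ)⁻¹ := by rw [zero_sub, cpow_neg_one]
    push_cast
    rw [tsum_cexp_eq ht0, Real.log_sqrt ht0.le, hs, h0]
    push_cast
    field_simp
    ring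
  rw [setIntegral_congr_fun measurableSet_Ioi hpt,
    integral_add ((hA.const_mul _)) ((hB.const_mul _)), integral_const_mul, integral_const_mul]
  have hf : ((i + 1)! : ℂ) ≠ 0 := by exact_mod_cast Nat.factorial_ne_zero _
  field_simp

/-- **Leibniz on `ξ(s) = ½ + ½ s(s−1) Λ₀(s)` at `s = 1`**: for `j ≥ 1`,
`2ξ^{(j)}(1) = j Λ₀^{(j−1)}(1) + j(j−1) Λ₀^{(j−2)}(1)`. [cite: Keiper1992, eqs. (3)–(5) p.766] -/
private theorem two_mul_iteratedDeriv_riemannXi_one {j : ℕ} (hj : 1 ≤ j) :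
    2 * iteratedDeriv j riemannXi 1 =
      (j : ℂ) * iteratedDeriv (j - 1) completedRiemannZeta₀ 1 +
        (j : ℂ) * ((j : ℂ) - 1) * iteratedDeriv (j - 2) completedRiemannZeta₀ 1 := by
  have hξ : riemannXi = fun s : ℂ ↦ 1 / 2 + s * (s - 1) / 2 * completedRiemannZeta₀ s := rfl
  have hp : ContDiff ℂ j (fun s : ℂ ↦ s * (s - 1) / 2) := by fun_prop
  have hL : ContDiffAt ℂ j completedRiemannZeta₀ 1 :=
    differentiable_completedZeta₀.contDiff.contDiffAt
  have hd : ∀ i : ℕ, iteratedDeriv i (fun s : ℂ ↦ s * (s - 1) / 2) 1 =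
      if i = 0 then 0 else if i = 1 then 1 / 2 else if i = 2 then 1 else 0 := by
    intro i
    have e : (fun s : ℂ ↦ s * (s - 1) / 2) = fun s ↦ (s ^ 2 - s) / 2 := by funext s; ring
    have hsq : ContDiffAt ℂ i (fun s : ℂ ↦ s ^ 2) 1 := by fun_prop
    have hid : ContDiffAt ℂ i (fun s : ℂ ↦ s) 1 := by fun_prop
    rw [e, iteratedDeriv_div_const, iteratedDeriv_fun_sub hsq hid, iteratedDeriv_pow,
      iteratedDeriv_fun_id]
    rcases i with _ | _ | _ | i
    · simp
    · norm_num [Nat.descFactorial]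
    · norm_num [Nat.descFactorial]
    · simp
  rw [hξ, iteratedDeriv_const_add (by omega) _, iteratedDeriv_fun_mul hp.contDiffAt hL,
    Finset.sum_eq_add 1 2 (by norm_num)]
  · rw [hd, hd, Nat.choose_one_right, Nat.cast_choose_two]
    norm_num
    ring
  · intro c _ hc
    rw [hd]
    rcases c with _ | _ | _ | c
    · simp
    · exact absurd rfl hc.1
    · exact absurd rfl hc.2
    · simp
  · intro h
    exact absurd (Finset.mem_range.2 (by omega)) h
  · intro h
    have : j < 2 := by simpa using h
    rw [Nat.choose_eq_zero_of_lt this]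
    simp

/-- **[Keiper1992] (5)–(7) — DISCHARGED**: `α_j = β_{j−2} + β_{j−1}` for `j ≥ 2`, where
`2ξ(s) = Σ α_j (s−1)^j`, `β₀ = 1 + γ/2 − log(2√π)` and `β_j = (1/j!)∫₁^∞ ψ(t)(log √t)^j t^{−1}(√t + (−1)^j) dt`
(`j ≥ 1`).  Printed proof («by induction on» Riemann's integral (3)): `2ξ(s) = 1 + ((s−1) + (s−1)²)·Λ₀(s)`
with `Λ₀(s) = ∫₁^∞ ψ(t)(t^{(1−s)/2} + t^{s/2}) dt/t` (Mathlib's `completedRiemannZeta₀`, folded onto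
`(1, ∞)` by `θ(t) = t^{−1/2}θ(1/t)`), whose Taylor coefficients at `1` are the `β_j` (differentiation under
the Mellin integral, `mellin_hasDerivAt_of_isBigO_rpow`) and `Λ₀(1) = α₁ = β₀` (tree `keiperAlpha_one`).
[cite: Keiper1992, eqs. (3), (5)–(7) p.766] -/
theorem Keiper1992_eq5_holds : Keiper1992_eq5 := by
  intro j hj
  obtain ⟨m, rfl⟩ : ∃ m, j = m + 2 := ⟨j - 2, by omega⟩
  simp only [Nat.add_sub_cancel, show m + 2 - 1 = m + 1 by omega]
  have hβ : ∀ n : ℕ, (keiperBeta n : ℂ) = iteratedDeriv n completedRiemannZeta₀ 1 / (n ! : ℂ) := by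
    intro n
    rcases Nat.eq_zero_or_pos n with rfl | hn
    · have h1 := two_mul_iteratedDeriv_riemannXi_one (le_refl 1)
      have hα := keiperAlpha_coe 1
      rw [keiperAlpha_one] at hα
      rw [hα, mul_div_assoc] at *
      simp only [Nat.sub_self, Nat.cast_one, one_mul, sub_self, mul_zero, zero_mul, add_zero,
        Nat.factorial_one, Nat.factorial_zero, div_one, iteratedDeriv_zero] at h1 ⊢
      rw [← h1]
    · exact keiperBeta_coe_of_pos hn
  have hα := keiperAlpha_coe (m + 2)
  rw [mul_div_assoc] at hα
  have h2 := two_mul_iteratedDeriv_riemannXi_one (show 1 ≤ m + 2 by omega)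
  simp only [Nat.add_sub_cancel, show m + 2 - 1 = m + 1 by omega] at h2
  apply Complex.ofReal_injective
  push_cast
  rw [hα, hβ m, hβ (m + 1)]
  have hf0 : (m ! : ℂ) ≠ 0 := by exact_mod_cast Nat.factorial_ne_zero _
  have hm1 : (m : ℂ) + 1 ≠ 0 := by exact_mod_cast Nat.succ_ne_zero m
  have hm2 : (m : ℂ) + 2 ≠ 0 := by exact_mod_cast Nat.succ_ne_zero (m + 1)
  have hm2' : (m : ℂ) + 1 + 1 ≠ 0 := by exact_mod_cast Nat.succ_ne_zero (m + 1)
  have e2 : 2 * (iteratedDeriv (m + 2) riemannXi 1 / ((m + 2)! : ℂ)) =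
      (2 * iteratedDeriv (m + 2) riemannXi 1) / ((m + 2)! : ℂ) := by ring
  rw [e2, h2, Nat.factorial_succ (m + 1), Nat.factorial_succ m]
  push_cast
  field_simp
  ring

end RiemannIntegral

end Literature.NumberTheory.LFunctions
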